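import Summits.QuantumFields.BalabanUV.T4Continuum.Support.SubstrateSectionOfRecordOne
import Summits.QuantumFields.BalabanUV.T4Continuum.Support.SubstrateProbesChartLev

/-!
# SUBSTRATE — [dict] D-8 ONE-RUN FACES AT THE REFERENCE POINT OF RECORD: COERCIVITY OF THE COVARIANT VECTOR OPERATOR, THE RADIUS `ρ⋆`,
# AND NE4 L3's ANALYTICITY FACE `hAan` AT THE TRIVIAL TOWER — EVERY SMALL-FIELD LETTER DISCHARGED (follower of `SubstrateSectionOfRecordOne`)

Cell `pub-balaban`, SUBSTRATE cell, seat `b2b-balaban-substrate-p2` (gen 5).  Summits-side under the LEAN PLACEMENT RULE.  HONEST FRAMING: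
rung (B)+1 of the FINITE-VOLUME T⁴ programme — NOT infinite volume, NOT a mass gap, NOT Clay; spine PROVED 0∕9; NE4 ∕ NE9 NOT PRINTED ∕ NOT
proved.  [folklore] bookkeeping only: no estimate of Bałaban's is asserted.

WHY.  `SubstrateSectionOfRecordOne` (W-19 = L-E13, p231141) inhabits the reading letters `(ι, hι, hdist)` on `SU(n)` and the regular-background
letters `(hU, hT, 0 < gammaV)` at the trivial configuration, and instantiates the PAIR-chart packages there.  This follower (L-E13b, typer (μ4))
does the same for the ONE-RUN faces the NE9 ∕ NE4 lines display.  WHICH DISPLAYED BINDER OF WHICH ROW IS INHABITED, AND AT WHICH DATUM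
(wording of record, (μ4)(iii): «binder INHABITED at the trivial datum (non-vacuity witness)» — never «binder DISCHARGED on the row's field class»):
* NE9 ENDs' ∕ theme-E's `hU hT hγV` (as displayed by `SubstrateTransporterSpeciesLev.coercive_vecOp_towerDataOf_of_regular` ∕ `rhoStarOfRecord`):
  INHABITED at the trivial tower `towerDataOf P ι av 1` of ANY gauge group read through a unitary `ι` with `hdist`, averagings fixing `1`
  (§1 **`coercive_vecOp_towerDataOf_one`** — `Coercive (gammaV |o| d a′ 0 0) (vecOp n_k (unitMod P) a′ (Γ k) (towerDataOf P ι av 1 k))`, free letter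
  `= gammaA d a′∕2`; `rhoStarOfRecord_one_pos`), and at BOTH factors of the section point of the `SU(n)` record `drivenRecordSU F K m′ gA gB` read
  through `fundamentalRep` at a background with `U.1 = 1` (§2 `coercive_vecOp_sectionOfRecord_fst_one` ∕ `_snd_one`) — these are exactly the
  `hcoA ∕ hcoB` binders of every generic `hslice_*` package;
* NE4 SKELETON L3's `hAan : ∃ ρ > 0, … ∈ Pr.Analytic ρ` (MAP §3: DISPLAYED, Q-S2 OPEN) in the MODEL family `covEntryFamilyLev` of
  `SubstrateProbesChartLev.covEntryFamilyLev_mem_analytic_rhoStarOfRecord`: INHABITED at the trivial tower (§1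
  **`covEntryFamilyLev_mem_analytic_towerDataOf_one`**, **`exists_covEntryFamilyLev_mem_analytic_towerDataOf_one`** — only `0 < a′` and the reading
  `(ι, hι, hdist)` remain) and, on the carriers OF RECORD, at the run-A factor of the `SU(n)` section point (§2
  `exists_covEntryFamilyLev_mem_analytic_recordOne_fst` ∕ `_snd` (run B at the run-B factor), plus the CLOSED form `…_recordOne_fst_one` at the background `⟨1, _⟩` itself — no
  hypothesis on `U`, substrate-p4's X2 INFO-1).
HONEST: identification ∕ non-vacuity at the trivial driving field only; at a non-trivial `V` the letters `α, τ` are Bałaban's one-step regularity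
estimates (never substrate) and nothing here discharges them on any row's field class; `hAan`'s NON-VANISHING input on the polydisc (Q-S2) is a
different, displayed matter — not touched; 0 estimate; NE4 ∕ NE9 NOT PRINTED ∕ NOT PROVED.
HONEST DEPENDENCY (cell line, verbatim): continuum YM on T⁴ ⇐ BetaPertH ∧ nine spine estimates (0/9 proved); BetaPertH ⇐ (D1) ∧ (D4) ∧
CAP+tail; G-an2-4 gates asym, D1 and NE2/3/4.
-/

noncomputable section

open scoped BigOperators Matrix Matrix.Norms.L2Operator

namespace Summit.QuantumFields.BalabanUV.T4Continuum.SubstrateSectionOfRecordOneFaces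

open Literature.MathematicalPhysics.QuantumFieldTheory.Balaban1983to89
open Literature.MathematicalPhysics.QuantumFieldTheory.Balaban1983to89.T4Continuum (T4Family)
open Literature.MathematicalPhysics.QuantumFieldTheory.Balaban1983to89.B5Prop11Plancherel (Tor fine)
open Literature.MathematicalPhysics.QuantumFieldTheory.Balaban1983to89.B5G183RateUnitTower (lev lev_neZero)
open Literature.MathematicalPhysics.QuantumFieldTheory.Balaban1983to89.T4BetaReadOutLipschitz (Probes tagSlice)
open Literature.MathematicalPhysics.QuantumLattice (fundamentalRep fundamentalRep_mem_unitaryGroup)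
open Summit.QuantumFields.BalabanUV.T4Continuum
open Summit.QuantumFields.BalabanUV.T4Continuum.CoerciveInverseTower (Coercive)
open Summit.QuantumFields.BalabanUV.T4Continuum.CovariantVectorCoercive (vecOp gammaV)
open Summit.QuantumFields.BalabanUV.T4Continuum.CovariantBlockAveraging (ContourSystem transport)
open Summit.QuantumFields.BalabanUV.T4Continuum.B13Carriers (TwoRuns)
open Summit.QuantumFields.BalabanUV.T4Continuum.SubstrateBackgroundTransporters (unitMod)
open Summit.QuantumFields.BalabanUV.T4Continuum.SubstrateBlockAvgContinuity (drivenRecordSU)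
open Summit.QuantumFields.BalabanUV.T4Continuum.SubstrateTransporterSpecies (TowerData towerDataOf)
open Summit.QuantumFields.BalabanUV.T4Continuum.SubstrateTransporterSpeciesLev (cPr aPr coercive_vecOp_towerDataOf_of_regular
  rhoStarOfRecord rhoStarOfRecord_pos)
open Summit.QuantumFields.BalabanUV.T4Continuum.SubstrateProbesOfRecord (cubeProbesC)
open Summit.QuantumFields.BalabanUV.T4Continuum.SubstrateProbesChartLev (covEntryFamilyLev covEntryFamilyLev_mem_analytic_rhoStarOfRecord)
open Summit.QuantumFields.BalabanUV.T4Continuum.SubstrateChartSection (sectionOfRecord)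
open Summit.QuantumFields.BalabanUV.T4Continuum.SubstrateSectionOfRecordOne
open Summit.QuantumFields.BalabanUV.T4Continuum.SubstrateTwoRunsDriven (DrivenRuns)

/-! ## §1 One run, any gauge group read through a unitary `ι` with `hdist`, averagings fixing `1`: the faces at the trivial tower -/

section OneRun

variable (P : Params) {G : Type} [GaugeGroup G] {o : Type} [Fintype o] [DecidableEq o]
  (Γ : (k : ℕ) → ContourSystem P.d (lev P.L k) (unitMod P)) (ι : G →* Matrix o o ℂ) (av : ∀ j, Averaging P j G)
  (hι : ∀ g, ι g ∈ Matrix.unitaryGroup o ℂ) (hdist : ∀ g : G, ‖ι g - 1‖ = dist1 g) (hav1 : ∀ j, (av j).avg 1 = 1) {a' : ℝ} (ha' : 0 < a')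

include hdist hav1 ha' in
/-- [folklore] **THE COVARIANT VECTOR OPERATOR IS COERCIVE AT THE TRIVIAL TOWER WITH THE FREE LETTER**: at every level `k ≤ K`,
`Coercive (gammaV |o| d a′ 0 0) (vecOp n_k (unitMod P) a′ (Γ k) (towerDataOf P ι av 1 k))` (`= gammaA d a′ ∕ 2` by `gammaV_zero_zero`) —
`coercive_vecOp_towerDataOf_of_regular` with `hU hT` discharged at `α = τ = 0`. -/
theorem coercive_vecOp_towerDataOf_one (k : Fin (P.K + 1)) :
    Coercive (gammaV (Fintype.card o) P.d a' 0 0) (vecOp (lev P.L k) (unitMod P) a' (Γ k) (towerDataOf P ι av (1 : GaugeField P 0 G) k)) :=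
  coercive_vecOp_towerDataOf_of_regular P Γ ι av hdist 1 ha' le_rfl le_rfl (regU_one P av hav1) (fun k _ _ μ _ => regT_towerDataOf_one P ι av hav1 k μ _) k

include hav1 in
/-- [folklore] **`ρ⋆` AT THE TRIVIAL TOWER IS A POSITIVE RADIUS WITH NO DISPLAYED SMALL-FIELD LETTER** (the `rhoStarOfRecord` of the trivial
configuration at `α = τ = 0`, `0 < gammaV … a′ 0 0`). -/
theorem rhoStarOfRecord_one_pos :
    0 < rhoStarOfRecord P Γ ι av hι hdist (1 : GaugeField P 0 G) ha' le_rfl le_rfl (regU_one P av hav1)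
      (fun k _ _ μ _ => regT_towerDataOf_one P ι av hav1 k μ _) (gammaV_zero_zero_pos _ _ _) :=
  rhoStarOfRecord_pos P Γ ι av hι hdist 1 ha' le_rfl le_rfl _ _ _

variable (R : TwoRuns G) {dirA dirB : ℕ → R.carriers.Dom → TowerData P o} {wt : ℕ → R.carriers.Dom → ℝ}
  (s : ℕ → ℂ) {T : Type} (kOf : R.carriers.Dom → ℕ) (tOf : R.carriers.Dom → T) (bOf b'Of : R.carriers.Dom → (Tor (unitMod P) × Fin P.d) × o)

include hav1 in
/-- [folklore] **NE4 L3's `hAan` FACE INHABITED AT THE TRIVIAL TOWER**: the level-lettered species-entry family at the chart centred at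
`towerDataOf P ι av 1 = 1` lies in `(cubeProbesC …).Analytic ρ⋆` with `ρ⋆ > 0` and NO displayed small-field letter (`covEntryFamilyLev_mem_analytic_rhoStarOfRecord`
at `α = τ = 0`). -/
theorem covEntryFamilyLev_mem_analytic_towerDataOf_one :
    tagSlice (covEntryFamilyLev R P (cPr P) (aPr P a') Γ (towerDataOf P ι av (1 : GaugeField P 0 G)) s kOf tOf bOf b'Of)
      ∈ (cubeProbesC R dirA dirB wt).Analytic
        (rhoStarOfRecord P Γ ι av hι hdist (1 : GaugeField P 0 G) ha' le_rfl le_rfl (regU_one P av hav1)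
          (fun k _ _ μ _ => regT_towerDataOf_one P ι av hav1 k μ _) (gammaV_zero_zero_pos _ _ _)) :=
  covEntryFamilyLev_mem_analytic_rhoStarOfRecord R P Γ s kOf tOf bOf b'Of ι av hι hdist 1 ha' le_rfl le_rfl _ _ _

include hι hdist hav1 ha' in
/-- [folklore] The same as an EXISTENTIAL — exactly NE4 L3's `hAan : ∃ ρ > 0, … ∈ Pr.Analytic ρ` at the trivial tower, hypothesis-free but for
`0 < a′` and the reading `(ι, hι, hdist)`. -/
theorem exists_covEntryFamilyLev_mem_analytic_towerDataOf_one :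
    ∃ ρ > 0, tagSlice (covEntryFamilyLev R P (cPr P) (aPr P a') Γ (towerDataOf P ι av (1 : GaugeField P 0 G)) s kOf tOf bOf b'Of)
      ∈ (cubeProbesC R dirA dirB wt).Analytic ρ :=
  ⟨_, rhoStarOfRecord_one_pos P Γ ι av hι hdist hav1 ha', covEntryFamilyLev_mem_analytic_towerDataOf_one P Γ ι av hι hdist hav1 ha' R s kOf tOf bOf b'Of⟩

end OneRun

/-! ## §2 At the `SU(n)` record `drivenRecordSU F K m′ gA gB`, `ι := fundamentalRep`, trivial driving field: both runs' faces -/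

section SU

variable {o : Type} [Fintype o] [DecidableEq o] [Nonempty o] (F : T4Family) (K m' : ℕ) (gA gB : ℕ → ℝ)
  (ΓA : (k : ℕ) → ContourSystem (F.P K).d (lev (F.P K).L k) (unitMod (F.P K)))
  (ΓB : (k : ℕ) → ContourSystem (F.P (K + 1)).d (lev (F.P (K + 1)).L k) (unitMod (F.P (K + 1))))
  {aA aB : ℝ} (haA : 0 < aA) (haB : 0 < aB) {U : (drivenRecordSU (n := o) F K m' gA gB).carriers.BgB} (hU : U.1 = 1)

include haA hU in
/-- [folklore] **RUN A's VECTOR OPERATORS ARE COERCIVE AT THE SECTION POINT OF THE TRIVIAL BACKGROUND, FREE LETTER** (every level `k ≤ K_A`;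
`ι := fundamentalRep o`; `hdist` by `rfl`, `hU hT` by W-19 §1∕§3). -/
theorem coercive_vecOp_sectionOfRecord_fst_one (k : Fin ((F.P K).K + 1)) :
    Coercive (gammaV (Fintype.card o) (F.P K).d aA 0 0)
      (vecOp (lev (F.P K).L k) (unitMod (F.P K)) aA (ΓA k) ((sectionOfRecord (drivenRecordSU (n := o) F K m' gA gB) (fundamentalRep o) U).1 k)) := by
  rw [SubstrateChartSection.sectionOfRecord_fst, transport_val_eq_one hU]
  exact coercive_vecOp_towerDataOf_one _ ΓA (fundamentalRep o) _ (fun _ => rfl) (drivenRecordSU_avA_one F K m' gA gB) haA k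

include haB hU in
/-- [folklore] run B twin (every level `k ≤ K_B = K_A + 1`). -/
theorem coercive_vecOp_sectionOfRecord_snd_one (k : Fin ((F.P (K + 1)).K + 1)) :
    Coercive (gammaV (Fintype.card o) (F.P (K + 1)).d aB 0 0)
      (vecOp (lev (F.P (K + 1)).L k) (unitMod (F.P (K + 1))) aB (ΓB k)
        ((sectionOfRecord (drivenRecordSU (n := o) F K m' gA gB) (fundamentalRep o) U).2 k)) := by
  rw [SubstrateChartSection.sectionOfRecord_snd, hU]
  exact coercive_vecOp_towerDataOf_one _ ΓB (fundamentalRep o) _ (fun _ => rfl) (drivenRecordSU_avB_one F K m' gA gB) haB k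

variable (s : ℕ → ℂ) {T : Type}

include haA hU in
/-- [folklore] **NE4 L3's `hAan` AT THE RECORD, RUN A**: on run A's carriers of record, the species-entry family at the chart centred at the run-A
factor of the section point of the trivial background is in `(cubeProbesC …).Analytic ρ` for some `ρ > 0` — NO displayed letter but `0 < a`. -/
theorem exists_covEntryFamilyLev_mem_analytic_recordOne_fst
    {dirA dirB : ℕ → (drivenRecordSU (n := o) F K m' gA gB).carriers.Dom → TowerData (F.P K) o}
    {wt : ℕ → (drivenRecordSU (n := o) F K m' gA gB).carriers.Dom → ℝ}
    (kOf : (drivenRecordSU (n := o) F K m' gA gB).carriers.Dom → ℕ) (tOf : (drivenRecordSU (n := o) F K m' gA gB).carriers.Dom → T)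
    (bOf b'Of : (drivenRecordSU (n := o) F K m' gA gB).carriers.Dom → (Tor (unitMod (F.P K)) × Fin (F.P K).d) × o) :
    ∃ ρ > 0, tagSlice (covEntryFamilyLev (drivenRecordSU (n := o) F K m' gA gB).toTwoRuns (F.P K) (cPr (F.P K)) (aPr (F.P K) aA) ΓA
        ((sectionOfRecord (drivenRecordSU (n := o) F K m' gA gB) (fundamentalRep o) U).1) s kOf tOf bOf b'Of)
      ∈ (cubeProbesC (drivenRecordSU (n := o) F K m' gA gB).toTwoRuns dirA dirB wt).Analytic ρ := by
  rw [SubstrateChartSection.sectionOfRecord_fst, transport_val_eq_one hU]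
  exact exists_covEntryFamilyLev_mem_analytic_towerDataOf_one _ ΓA (fundamentalRep o) _ fundamentalRep_mem_unitaryGroup (fun _ => rfl)
    (drivenRecordSU_avA_one F K m' gA gB) haA _ s kOf tOf bOf b'Of

include haB hU in
/-- [folklore] **NE4 L3's `hAan` AT THE RECORD, RUN B**: the same on run B's torus `F.P (K+1)`, at the run-B factor of the section point (`U.1 = 1` itself). -/
theorem exists_covEntryFamilyLev_mem_analytic_recordOne_snd
    {dirA dirB : ℕ → (drivenRecordSU (n := o) F K m' gA gB).carriers.Dom → TowerData (F.P (K + 1)) o}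
    {wt : ℕ → (drivenRecordSU (n := o) F K m' gA gB).carriers.Dom → ℝ}
    (kOf : (drivenRecordSU (n := o) F K m' gA gB).carriers.Dom → ℕ) (tOf : (drivenRecordSU (n := o) F K m' gA gB).carriers.Dom → T)
    (bOf b'Of : (drivenRecordSU (n := o) F K m' gA gB).carriers.Dom → (Tor (unitMod (F.P (K + 1))) × Fin (F.P (K + 1)).d) × o) :
    ∃ ρ > 0, tagSlice (covEntryFamilyLev (drivenRecordSU (n := o) F K m' gA gB).toTwoRuns (F.P (K + 1)) (cPr (F.P (K + 1))) (aPr (F.P (K + 1)) aB) ΓB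
        ((sectionOfRecord (drivenRecordSU (n := o) F K m' gA gB) (fundamentalRep o) U).2) s kOf tOf bOf b'Of)
      ∈ (cubeProbesC (drivenRecordSU (n := o) F K m' gA gB).toTwoRuns dirA dirB wt).Analytic ρ := by
  rw [SubstrateChartSection.sectionOfRecord_snd, hU]
  exact exists_covEntryFamilyLev_mem_analytic_towerDataOf_one _ ΓB (fundamentalRep o) _ fundamentalRep_mem_unitaryGroup (fun _ => rfl)
    (drivenRecordSU_avB_one F K m' gA gB) haB _ s kOf tOf bOf b'Of

include haA in
/-- [folklore] **THE CLOSED FORM** (substrate-p4 X2 INFO-1): run A's `hAan` at the trivial background `⟨1, _⟩ : C.BgB` of the record ITSELF — no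
hypothesis on the background (the record's admissible classes are unrestricted, `B13Carriers.TwoRuns.univ`). -/
theorem exists_covEntryFamilyLev_mem_analytic_recordOne_fst_one
    {dirA dirB : ℕ → (drivenRecordSU (n := o) F K m' gA gB).carriers.Dom → TowerData (F.P K) o}
    {wt : ℕ → (drivenRecordSU (n := o) F K m' gA gB).carriers.Dom → ℝ}
    (kOf : (drivenRecordSU (n := o) F K m' gA gB).carriers.Dom → ℕ) (tOf : (drivenRecordSU (n := o) F K m' gA gB).carriers.Dom → T)
    (bOf b'Of : (drivenRecordSU (n := o) F K m' gA gB).carriers.Dom → (Tor (unitMod (F.P K)) × Fin (F.P K).d) × o) :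
    ∃ ρ > 0, tagSlice (covEntryFamilyLev (drivenRecordSU (n := o) F K m' gA gB).toTwoRuns (F.P K) (cPr (F.P K)) (aPr (F.P K) aA) ΓA
        ((sectionOfRecord (drivenRecordSU (n := o) F K m' gA gB) (fundamentalRep o)
          (⟨1, Set.mem_univ _⟩ : (drivenRecordSU (n := o) F K m' gA gB).carriers.BgB)).1) s kOf tOf bOf b'Of)
      ∈ (cubeProbesC (drivenRecordSU (n := o) F K m' gA gB).toTwoRuns dirA dirB wt).Analytic ρ :=
  exists_covEntryFamilyLev_mem_analytic_recordOne_fst F K m' gA gB ΓA haA (U := ⟨1, Set.mem_univ _⟩) rfl s kOf tOf bOf b'Of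

end SU

end Summit.QuantumFields.BalabanUV.T4Continuum.SubstrateSectionOfRecordOneFaces

end
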